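import Literature.MathematicalPhysics.QuantumLattice.HubbardModel
import Literature.MathematicalPhysics.QuantumLattice.PairCorrelations
import Literature.MathematicalPhysics.QuantumLattice.DWaveSource
import Literature.MathematicalPhysics.QuantumLattice.DWaveSourceProofs
import Literature.MathematicalPhysics.QuantumLattice.DWaveOrderParameterProofs
import HarnessLib

/-!
# Route `AposterioriCapRg` — crux `SsbToEvenTorusLro` (stmt-HubbardSuperconductivity-1315),
# line `number-projected-canonical-slope`, stub `stub_slopeOfChord`

What is proved (`stub_slopeOfChord`): the number-projected chord bound (CHORD) of the line,
Koma–Tasaki `d`-wave order `0 < m := dWaveOrderParameter U μ` and the sourced number-concentration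
hypothesis (T) give the CANONICAL attractive block slope at density `1 - δ`: along the even sides
`L = 2k+2`, for every block scale `R ≥ 1`, every `κ < 0` and every `ε > 0`, eventually in `k`,
`E_sec(H_L + κ W_R) - E_sec(H_L) ≤ κ (m² - ε) L²` on the sector `N = 2⌊(1-δ)L²/2⌋`, `S^z = 0`.

Proof (pure real analysis / filter bookkeeping, no fermions):
* (CHORD) at `ρ₀ = (1-δ)/4` gives a constant `C ≥ 0` and, for `0 ≤ s < h`, `D ≥ 0`,
  `E_sec(H + κW_R) - E_sec(H) ≤ κ L² dens_L(s)² + C h L² + C(1+|κ|)(D+1)`, valid once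
  `(1-δ)L²/4 ≤ ⌊(1-δ)L²/2⌋ ≤ (1-δ)L²/2` (true for `L² ≥ 4/(1-δ)`: `Nat.lt_floor_add_one`,
  `Nat.floor_le`).
* The staircase is monotone, so `m ≤ liminf_L dens_{L+1}(s)` for EVERY `s > 0`
  (`dWaveOrderParameter_le_liminf`); with `m' = m - min(m/2, ε/(8m))`, `0 ≤ m' < m`,
  `m'² ≥ m² - ε/4`, `Filter.eventually_lt_of_lt_liminf` gives `m' < dens_{L+1}(s)` eventually in
  `L`, hence (as `κ < 0`) `κ L² dens² ≤ κ (m² - ε/4) L² = κ m² L² + |κ|(ε/4)L²`.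
* `η := |κ|ε/(8(C(1+|κ|)+1))`; (T) at accuracy `η²` yields `h₀`; `h := min(h₀/2, |κ|ε/(4(C+1)))`,
  `s = h/2`, `D := η L²`: then `C h L² ≤ |κ|(ε/4)L²`, `C(1+|κ|) η L² ≤ |κ|(ε/8)L²`, and
  `C(1+|κ|) ≤ |κ|(ε/8)L²` for `L` large; the `∀ᶠ L` statements at side `L+1` are read off at
  `L = 2k+1`.
* Summing, the three error terms are absorbed into `|κ| ε L²`, i.e. the bound `κ(m² - ε)L²`.

Sources: T. Koma, H. Tasaki, J. Stat. Phys. 76 (1994) 745, §1 (order of limits in the order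
parameter; the monotone staircase) — used only through the tree lemmas of
`DWaveOrderParameterProofs.lean`. [folklore]
-/

noncomputable section

namespace Summit.HubbardSuperconductivity.HubbardSuperconductivity.Theorems

set_option linter.dupNamespace false

open Literature.MathematicalPhysics.QuantumLattice Literature.Probability.LatticeModels Matrix
open Filter Set
open scoped Matrix ComplexOrder ComplexConjugate Matrix.Norms.L2Operator

/-- Real bookkeeping of `stub_slopeOfChord`: the chord bound
`E ≤ κ L² d² + C h L² + C(1+|κ|)(η L² + 1)` with `0 ≤ m' < d`, `m² - ε/4 ≤ m'²`, `C h ≤ |κ| ε/4`,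
`C(1+|κ|) η ≤ |κ| ε/8`, `C(1+|κ|) ≤ |κ|(ε/8) L²` and `κ < 0` gives `E ≤ κ (m² - ε) L²`.
[folklore] -/
private theorem slope_combine {E κ m m' d C h η Lr ε : ℝ} (hκ : κ < 0) (hε : 0 < ε)
    (hbound : E ≤ κ * (Lr ^ 2 * d ^ 2) + C * h * Lr ^ 2 + C * (1 + |κ|) * (η * Lr ^ 2 + 1))
    (hm' : 0 ≤ m') (hd : m' < d) (hm'sq : m ^ 2 - ε / 4 ≤ m' ^ 2)
    (hCh : C * h ≤ -κ * (ε / 4)) (hAη : C * (1 + |κ|) * η ≤ -κ * (ε / 8))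
    (hAL : C * (1 + |κ|) ≤ -κ * (ε / 8) * Lr ^ 2) :
    E ≤ κ * (m ^ 2 - ε) * Lr ^ 2 := by
  have hL : 0 ≤ Lr ^ 2 := sq_nonneg _
  have h1 : m' ^ 2 ≤ d ^ 2 := pow_le_pow_left₀ hm' hd.le 2
  have h2 : κ * (Lr ^ 2 * d ^ 2) ≤ κ * (Lr ^ 2 * (m ^ 2 - ε / 4)) :=
    mul_le_mul_of_nonpos_left (mul_le_mul_of_nonneg_left (hm'sq.trans h1) hL) hκ.le
  have h3 : C * h * Lr ^ 2 ≤ -κ * (ε / 4) * Lr ^ 2 := mul_le_mul_of_nonneg_right hCh hL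
  have h4 : C * (1 + |κ|) * η * Lr ^ 2 ≤ -κ * (ε / 8) * Lr ^ 2 :=
    mul_le_mul_of_nonneg_right hAη hL
  have h5 : 0 ≤ -κ * ε * Lr ^ 2 := mul_nonneg (mul_nonneg (neg_pos.2 hκ).le hε.le) hL
  linarith [h2, h3, h4, h5, hAL, hbound]

/-- Density bookkeeping of `stub_slopeOfChord`: for `0 < δ < 1` and a real side `Lr` with
`4/(1-δ) ≤ Lr²`, the pair number `n = ⌊(1-δ)Lr²/2⌋` satisfies `(1-δ)/4 · Lr² ≤ n` and
`2n ≤ (1-δ) Lr²`. [folklore] -/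
private theorem floor_density_window {δ Lr : ℝ} (hδ : δ ∈ Set.Ioo (0 : ℝ) 1)
    (hbig : 4 / (1 - δ) ≤ Lr ^ 2) :
    (1 - δ) / 4 * Lr ^ 2 ≤ ((⌊(1 - δ) * Lr ^ 2 / 2⌋₊ : ℕ) : ℝ) ∧
      2 * ((⌊(1 - δ) * Lr ^ 2 / 2⌋₊ : ℕ) : ℝ) ≤ (1 - δ) * Lr ^ 2 := by
  have h1δ : 0 < 1 - δ := by linarith [hδ.2]
  have hx0 : 0 ≤ (1 - δ) * Lr ^ 2 / 2 := by positivity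
  have h4 : 4 ≤ Lr ^ 2 * (1 - δ) := (div_le_iff₀ h1δ).1 hbig
  refine ⟨?_, ?_⟩
  · have := Nat.lt_floor_add_one ((1 - δ) * Lr ^ 2 / 2)
    linarith
  · have := Nat.floor_le hx0
    linarith

/-- **(SLOPE) stub_slopeOfChord** — CHORD + Koma–Tasaki order + (T) ⇒ the CANONICAL attractive block slope at density
`1 − δ` is at least `m²`: along even sides `L = 2k+2`, for every block scale `R ≥ 1`, every `κ < 0` and every `ε > 0`,
`E_sec(H + κW_R) − E_sec(H) ≤ κ(m² − ε)L²` eventually, `m = dWaveOrderParameter U μ`, `N_L = 2⌊(1−δ)L²/2⌋`. Real analysis: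
unpack the two `liminf`s (`le_dWaveOrderParameter_iff_forall`, `dWaveSourceDensity_nonneg`, `abs_dWaveSourceDensity_le`),
pick `0 < s < h` small with `dens_L(s) ≥ m − ε'` eventually and `h` inside (T)'s window, take `D = √(ε''·L⁴)` from (T),
`ρ₀ = (1−δ)/4`, and absorb `C h L² + C(1+|κ|)(D+1)` into `|κ|εL²`. PROVABLE NOW. [folklore] -/
theorem stub_slopeOfChord :
    (∀ (U μ : ℝ) (R : ℕ), 0 < R → ∀ ρ₀ : ℝ, 0 < ρ₀ → ∃ C : ℝ, 0 ≤ C ∧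
      ∀ (L : ℕ) [NeZero L] (n : ℕ) (s h κ D : ℝ),
        ρ₀ * (L : ℝ) ^ 2 ≤ (n : ℝ) → 2 * n ≤ L ^ 2 → 0 ≤ s → s < h → κ ≤ 0 → 0 ≤ D →
        (∀ φ : Fock (Orb (FermionTorus 2 L)), (dWaveSourceTorus L U μ h).IsGroundStateVector φ →
            star φ ⬝ᵥ φ = 1 →
            (star (totalNumber *ᵥ φ - ((2 * n : ℕ) : ℂ) • φ) ⬝ᵥ (totalNumber *ᵥ φ - ((2 * n : ℕ) : ℂ) • φ)).re ≤ D ^ 2) →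
        (hubbardTorus 2 L 1 U + (κ : ℂ) • (((((R : ℝ) ^ 4)⁻¹ : ℝ) : ℂ) • ∑ a : TorusSite 2 L, (∑ u : Fin 2 → Fin R, localPair dWaveFormFactor L (a + fun i => ((u i : ℕ) : ZMod L)))ᴴ * (∑ u : Fin 2 → Fin R, localPair dWaveFormFactor L (a + fun i => ((u i : ℕ) : ZMod L))))).minEnergyOn (szSector (2 * n) 0) -
            (hubbardTorus 2 L 1 U).minEnergyOn (szSector (2 * n) 0) ≤
          κ * ((L : ℝ) ^ 2 * dWaveSourceDensity L U μ s ^ 2) + C * h * (L : ℝ) ^ 2 + C * (1 + |κ|) * (D + 1)) →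
    ∀ (U δ μ : ℝ), δ ∈ Set.Ioo (0:ℝ) 1 → HasDWaveOrder U μ →
      (∀ ε : ℝ, 0 < ε → ∃ h₀ : ℝ, 0 < h₀ ∧ ∀ h ∈ Set.Ioo (0:ℝ) h₀, ∀ᶠ L : ℕ in Filter.atTop,
        ∀ φ : Fock (Orb (FermionTorus 2 (L + 1))), (dWaveSourceTorus (L + 1) U μ h).IsGroundStateVector φ →
          star φ ⬝ᵥ φ = 1 →
          (star (totalNumber *ᵥ φ - ((2 * ⌊(1 - δ) * ((L + 1 : ℕ) : ℝ) ^ 2 / 2⌋₊ : ℕ) : ℂ) • φ) ⬝ᵥ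
              (totalNumber *ᵥ φ - ((2 * ⌊(1 - δ) * ((L + 1 : ℕ) : ℝ) ^ 2 / 2⌋₊ : ℕ) : ℂ) • φ)).re ≤
            ε * ((L + 1 : ℕ) : ℝ) ^ 4) →
      ∀ R : ℕ, 0 < R → ∀ κ : ℝ, κ < 0 → ∀ ε : ℝ, 0 < ε → ∀ᶠ k : ℕ in Filter.atTop,
        (hubbardTorus 2 (2 * k + 1 + 1) 1 U + (κ : ℂ) • (((((R : ℝ) ^ 4)⁻¹ : ℝ) : ℂ) • ∑ a : TorusSite 2 (2 * k + 1 + 1), (∑ u : Fin 2 → Fin R, localPair dWaveFormFactor (2 * k + 1 + 1) (a + fun i => ((u i : ℕ) : ZMod (2 * k + 1 + 1))))ᴴ * (∑ u : Fin 2 → Fin R, localPair dWaveFormFactor (2 * k + 1 + 1) (a + fun i => ((u i : ℕ) : ZMod (2 * k + 1 + 1)))))).minEnergyOn (szSector (2 * ⌊(1 - δ) * ((2 * k + 1 + 1 : ℕ) : ℝ) ^ 2 / 2⌋₊) 0) -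
            (hubbardTorus 2 (2 * k + 1 + 1) 1 U).minEnergyOn (szSector (2 * ⌊(1 - δ) * ((2 * k + 1 + 1 : ℕ) : ℝ) ^ 2 / 2⌋₊) 0) ≤
          κ * (dWaveOrderParameter U μ ^ 2 - ε) * ((2 * k + 1 + 1 : ℕ) : ℝ) ^ 2 := by
  intro hChord U δ μ hδ hOrd hT R hR κ hκ ε hε
  -- the order parameter `m > 0` and `|κ| = -κ > 0`
  have hm : 0 < dWaveOrderParameter U μ := (hasDWaveOrder_iff U μ).1 hOrd
  have hκ' : 0 < -κ := neg_pos.2 hκ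
  -- (1) the chord constant at `ρ₀ = (1-δ)/4`
  have h1δ : 0 < 1 - δ := by linarith [hδ.2]
  obtain ⟨C, hC0, hC⟩ := hChord U μ R hR ((1 - δ) / 4) (by positivity)
  -- (2) a level `m'` just below the order parameter, `m² - ε/4 ≤ m'²`
  obtain ⟨m', hm'0, hm'lt, hm'sq⟩ : ∃ m' : ℝ, 0 ≤ m' ∧ m' < dWaveOrderParameter U μ ∧
      dWaveOrderParameter U μ ^ 2 - ε / 4 ≤ m' ^ 2 := by
    set m := dWaveOrderParameter U μ with hm_def
    refine ⟨m - min (m / 2) (ε / (8 * m)), ?_, ?_, ?_⟩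
    · linarith [min_le_left (m / 2) (ε / (8 * m))]
    · linarith [lt_min (half_pos hm) (show 0 < ε / (8 * m) by positivity)]
    · have h2 : 2 * m * min (m / 2) (ε / (8 * m)) ≤ ε / 4 :=
        calc 2 * m * min (m / 2) (ε / (8 * m)) ≤ 2 * m * (ε / (8 * m)) := by
              gcongr
              exact min_le_right _ _
          _ = ε / 4 := by field_simp; ring
      nlinarith [sq_nonneg (min (m / 2) (ε / (8 * m)))]
  -- (3) the concentration accuracy `η²`, `η = |κ|ε/(8(C(1+|κ|)+1))`, and (T)'s window `h₀`
  have hA0 : 0 ≤ C * (1 + |κ|) := by positivity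
  set η : ℝ := -κ * ε / (8 * (C * (1 + |κ|) + 1)) with hη_def
  have hη0 : 0 < η := by positivity
  have hAη : C * (1 + |κ|) * η ≤ -κ * (ε / 8) := by
    rw [hη_def, mul_div_assoc', div_le_iff₀ (by positivity)]
    nlinarith [mul_nonneg hκ'.le hε.le]
  obtain ⟨h₀, hh₀, hT'⟩ := hT (η ^ 2) (by positivity)
  -- (4) the source strength `h ∈ (0, h₀)` with `C h ≤ |κ| ε/4`, and `s = h/2`
  set h : ℝ := min (h₀ / 2) (-κ * ε / (4 * (C + 1))) with hh_def
  have hh0 : 0 < h := lt_min (half_pos hh₀) (by positivity)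
  have hhlt : h < h₀ := (min_le_left _ _).trans_lt (half_lt_self hh₀)
  have hCh : C * h ≤ -κ * (ε / 4) := by
    refine (mul_le_mul_of_nonneg_left (min_le_right _ _) hC0).trans ?_
    rw [mul_div_assoc', div_le_iff₀ (by positivity)]
    nlinarith [mul_nonneg hκ'.le hε.le]
  have hs0 : (0 : ℝ) ≤ h / 2 := (half_pos hh0).le
  have hsh : h / 2 < h := half_lt_self hh0
  -- (5) eventually in the side `L+1`: the density at `s` exceeds `m'` (monotone staircase:
  -- `m ≤ liminf` at EVERY positive source), and (T) holds at `h`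
  have hev₁ : ∀ᶠ L : ℕ in atTop, m' < dWaveSourceDensity (L + 1) U μ (h / 2) :=
    eventually_lt_of_lt_liminf
      (hm'lt.trans_le (dWaveOrderParameter_le_liminf U μ (half_pos hh0)))
      (isBoundedUnder_of_eventually_ge (a := 0)
        (Eventually.of_forall fun L => dWaveSourceDensity_nonneg U μ hs0))
  obtain ⟨N₁, hN₁⟩ := eventually_atTop.1 (hev₁.and (hT' h ⟨hh0, hhlt⟩))
  -- (6) largeness thresholds for the side, then pass to the even sides `2k+2 = (2k+1)+1`
  obtain ⟨N₂, hN₂⟩ := exists_nat_ge (4 / (1 - δ))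
  obtain ⟨N₃, hN₃⟩ := exists_nat_ge (8 * (C * (1 + |κ|)) / (-κ * ε))
  filter_upwards [eventually_ge_atTop N₁, eventually_ge_atTop N₂, eventually_ge_atTop N₃] with
    k hk₁ hk₂ hk₃
  obtain ⟨hdens, hvar⟩ := hN₁ (2 * k + 1) (by omega)
  have hLr1 : (1 : ℝ) ≤ ((2 * k + 1 + 1 : ℕ) : ℝ) := by
    exact_mod_cast (show 1 ≤ 2 * k + 1 + 1 by omega)
  have hLsq : ((2 * k + 1 + 1 : ℕ) : ℝ) ≤ ((2 * k + 1 + 1 : ℕ) : ℝ) ^ 2 := by nlinarith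
  have hLN₂ : (N₂ : ℝ) ≤ ((2 * k + 1 + 1 : ℕ) : ℝ) := by
    exact_mod_cast (show N₂ ≤ 2 * k + 1 + 1 by omega)
  have hLN₃ : (N₃ : ℝ) ≤ ((2 * k + 1 + 1 : ℕ) : ℝ) := by
    exact_mod_cast (show N₃ ≤ 2 * k + 1 + 1 by omega)
  -- the density window `(1-δ)L²/4 ≤ n ≤ L²/2`, `n = ⌊(1-δ)L²/2⌋`
  obtain ⟨hρ, h2n'⟩ := floor_density_window hδ (hN₂.trans (hLN₂.trans hLsq))
  have h2n : 2 * ⌊(1 - δ) * ((2 * k + 1 + 1 : ℕ) : ℝ) ^ 2 / 2⌋₊ ≤ (2 * k + 1 + 1) ^ 2 := by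
    have : ((2 * ⌊(1 - δ) * ((2 * k + 1 + 1 : ℕ) : ℝ) ^ 2 / 2⌋₊ : ℕ) : ℝ) ≤
        (((2 * k + 1 + 1) ^ 2 : ℕ) : ℝ) := by
      rw [Nat.cast_mul, Nat.cast_pow, Nat.cast_ofNat]
      nlinarith [hδ.1, sq_nonneg (((2 * k + 1 + 1 : ℕ) : ℝ))]
    exact_mod_cast this
  -- the constant error term is `≤ |κ|(ε/8)L²` for `L` large
  have hAL : C * (1 + |κ|) ≤ -κ * (ε / 8) * ((2 * k + 1 + 1 : ℕ) : ℝ) ^ 2 := by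
    have h1 : 8 * (C * (1 + |κ|)) / (-κ * ε) ≤ ((2 * k + 1 + 1 : ℕ) : ℝ) ^ 2 :=
      hN₃.trans (hLN₃.trans hLsq)
    rw [div_le_iff₀ (by positivity)] at h1
    nlinarith [h1]
  -- (7) the chord bound at side `2k+2`, `n = ⌊(1-δ)L²/2⌋`, `s = h/2`, `D = η L²`, and summation
  have hD0 : (0 : ℝ) ≤ η * ((2 * k + 1 + 1 : ℕ) : ℝ) ^ 2 := by positivity
  have key := hC (2 * k + 1 + 1) ⌊(1 - δ) * ((2 * k + 1 + 1 : ℕ) : ℝ) ^ 2 / 2⌋₊ (h / 2) h κ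
    (η * ((2 * k + 1 + 1 : ℕ) : ℝ) ^ 2) hρ h2n hs0 hsh hκ.le hD0
    (fun φ hφ hφ1 => (hvar φ hφ hφ1).trans_eq (by ring))
  exact slope_combine hκ hε key hm'0 hdens hm'sq hCh hAη hAL

end Summit.HubbardSuperconductivity.HubbardSuperconductivity.Theorems

end
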